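import Mathlib.NumberTheory.LSeries.DirichletContinuation
import Mathlib.NumberTheory.DirichletCharacter.Basic
import Mathlib.Algebra.Squarefree.Basic
import Literature.NumberTheory.LFunctions.NoRealZeroUpTo
import HarnessLib

/-!
# A positive proportion of quadratic Dirichlet `L`-functions have no real zero on `[0, 1]`
# (Conrey–Soundararajan 2002, Theorem 1)

Statement layer for the column REALCHAR (real zeros of real Dirichlet characters) — the printed
PROPORTION frontier, all conductors, to sit next to the certified RANGE leaves
(`Literature.NumberTheory.LFunctions.NoRealZeroOddUpTo Q`: no real zero in `(0, 1)` for EVERY odd real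
primitive character of modulus `3 ≤ q ≤ Q`). Source: J. B. Conrey, K. Soundararajan, *Real zeros of
quadratic Dirichlet `L`-functions*, Invent. Math. 150 (2002) 1–44 [ConreySoundararajan2002]; held copy
= arXiv:math/0111013 (tex), §1.

## What the source prints (§1)

"For an integer `d ≡ 0`, or `1 (mod 4)` we put `χ_d(n) = (d/n)`, so that `χ_d` is a real character
with conductor at most `|d|`. If `d` is an odd, positive, square-free integer then `χ_{−8d}` is a
real, primitive character with conductor `8d`, and with `χ_{−8d}(−1) = −1`.
**Theorem 1** For at least `20%` of the odd square-free integers `d ≥ 0` we have `L(σ, χ_{−8d}) > 0`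
for `0 ≤ σ ≤ 1`. More precisely, for all large `x` the number of odd positive square-free integers
`d ≤ x` such that `L(σ, χ_{−8d}) > 0` for all `0 ≤ σ ≤ 1` exceeds `(1/5)(4x/π²)`."
(`4x/π²` is the asymptotic count of odd square-free `d ≤ x`.) Before it: "the state of knowledge
could not exclude the possibility that every Dirichlet `L`-function of sufficiently large conductor
has a non-trivial real zero. In this paper we eliminate this possibility".

## Typing notes

* `χ_{−8d}` is rendered WITHOUT a Kronecker-symbol construction, through the source's own
  description: an odd (`χ(−1) = −1`), primitive, quadratic Dirichlet character of modulus `8d`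
  (`d` odd, positive, square-free). There is exactly one such character (the real primitive
  characters mod `8d` are `χ_{±8d}`, of which `χ_{−8d}` is the odd one), so quantifying "for every
  such `χ` mod `8d`" states the printed property of `χ_{−8d}`; the file does not use uniqueness.
* `L(σ, χ) > 0` (a real inequality for the real-valued `L(σ, χ_{−8d})`) is `0 < (χ.LFunction σ).re`.
* "for all large `x`" is `∃ x₀, ∀ x ≥ x₀`; the count is over `d ∈ [1, ⌊x⌋]`.

## Contents

* `ConreySoundararajan2002.PositiveOnUnitInterval d` — the printed property of `d`
  («`L(σ, χ_{−8d}) > 0` for all `0 ≤ σ ≤ 1`»);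
* `conreySoundararajan2002_theorem1` — NAMED FACT, Theorem 1 (the "More precisely" count) AS PRINTED;
* PROVED: `ConreySoundararajan2002.twenty_percent` — the first sentence of Theorem 1 from the second
  (for large `x`, more than `(1/5)·(4x/π²)` good `d ≤ x`), and the comparison with the certified
  leaves `ConreySoundararajan2002.noRealZero_of_leaf`: under `NoRealZeroOddUpTo Q`, for EVERY odd
  square-free `d ≥ 1` with `8d ≤ Q` the character(s) above have no zero in `(0, 1)` (range: 100 %,
  proportion: all conductors — the two statements are logically independent).

Index only: the two further consequences announced in §1 (for at least `20%` of the `−8d`, the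
rectangle `σ ∈ [0,1], |t| ≤ c/log x` is zero-free; the number of `−8d`, `d ≤ x`, with a zero in
`[σ, 1]` is `≪ x^{1−(1−ε)(σ−1/2)}`), and the remark that the method applies to fundamental
discriminants in any arithmetic progression.

LABEL: instrument / statement layer (printed frontier, proportion axis). WHAT THIS IS NOT: not a
statement about every character (Chowla's conjecture `L(σ, χ) ≠ 0` on `[1/2, 1]` stays open); no
bearing on parity.

## References

* [ConreySoundararajan2002] J. B. Conrey, K. Soundararajan, *Real zeros of quadratic Dirichlet
  `L`-functions*, Invent. Math. 150 (2002), no. 1, 1–44, doi:10.1007/s00222-002-0227-x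
  = arXiv:math/0111013: §1, Theorem 1 and the surrounding paragraph.
* [Watkins2004RealZeros] M. Watkins, *Real zeros of real odd Dirichlet `L`-functions*, Math. Comp. 73
  (2004) 415–423 (the RANGE axis: no positive real zero for odd `χ`, `d ≤ 3·10⁸`; tree leaf family
  `NoRealZeroOddUpTo`).
-/

noncomputable section

open Finset Real

namespace Literature.NumberTheory.LFunctions

namespace ConreySoundararajan2002

/-- The printed property of an odd positive square-free `d`: «`L(σ, χ_{−8d}) > 0` for all
`0 ≤ σ ≤ 1`», with `χ_{−8d}` described as in the source — an odd, primitive, quadratic (real)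
Dirichlet character of modulus `8d` (there is exactly one; the statement quantifies over all such).
[cite: ConreySoundararajan2002, §1 Theorem 1 and the preceding paragraph] -/
def PositiveOnUnitInterval (d : ℕ) : Prop :=
  ∀ [NeZero (8 * d)] (χ : DirichletCharacter ℂ (8 * d)), χ.IsPrimitive → χ.IsQuadratic → χ.Odd →
    ∀ σ : ℝ, 0 ≤ σ → σ ≤ 1 → 0 < (χ.LFunction (σ : ℂ)).re

/-- The counting set of Theorem 1: odd positive square-free `d ≤ x` with `L(σ, χ_{−8d}) > 0` on
`[0, 1]`. [cite: ConreySoundararajan2002, §1 Theorem 1] -/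
def goodCount (x : ℝ) : ℕ :=
  open scoped Classical in
  ((Finset.Icc 1 ⌊x⌋₊).filter (fun d => Odd d ∧ Squarefree d ∧ PositiveOnUnitInterval d)).card

end ConreySoundararajan2002

/-- **Conrey–Soundararajan 2002, Theorem 1** (NAMED FACT, AS PRINTED — the "More precisely"
sentence): for all large `x`, the number of odd positive square-free integers `d ≤ x` such that
`L(σ, χ_{−8d}) > 0` for all `0 ≤ σ ≤ 1` exceeds `(1/5)(4x/π²)`. Not proved here (mollified first and
second moments of `L(σ, χ_{−8d})` near the real axis and Selberg's argument-principle lemma, §§2–6 of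
the source). [cite: ConreySoundararajan2002, §1 Theorem 1] -/
def conreySoundararajan2002_theorem1 : Prop :=
  ∃ x₀ : ℝ, ∀ x : ℝ, x₀ ≤ x →
    (1 / 5 : ℝ) * (4 * x / Real.pi ^ 2) < (ConreySoundararajan2002.goodCount x : ℝ)

namespace ConreySoundararajan2002

/-- The number of odd square-free `d` in `[1, ⌊x⌋]`. [cite: ConreySoundararajan2002, §1 Theorem 1] -/
def oddSquarefreeCount (x : ℝ) : ℕ :=
  open scoped Classical in
  ((Finset.Icc 1 ⌊x⌋₊).filter (fun d => Odd d ∧ Squarefree d)).card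

/-- The good `d` are among the odd square-free `d ≤ x`. [cite: ConreySoundararajan2002, §1 Theorem 1] -/
theorem goodCount_le_oddSquarefreeCount (x : ℝ) : goodCount x ≤ oddSquarefreeCount x := by
  classical
  unfold goodCount oddSquarefreeCount
  apply Finset.card_le_card
  intro d hd
  simp only [Finset.mem_filter] at hd ⊢
  exact ⟨hd.1, hd.2.1, hd.2.2.1⟩

/-- **"For at least 20% …"** — the first sentence of Theorem 1 read off the second (PROVED modulo the
fact): for all large `x`, `goodCount x > (1/5)·(4x/π²)`, i.e. more than one fifth of the asymptotic
number `4x/π²` of odd square-free `d ≤ x`; in particular `goodCount x → ∞`, so infinitely many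
quadratic Dirichlet `L`-functions `L(s, χ_{−8d})` are positive throughout `[0, 1]` ("we eliminate
this possibility"). [cite: ConreySoundararajan2002, §1 Theorem 1] -/
theorem twenty_percent (h : conreySoundararajan2002_theorem1) :
    ∀ N : ℝ, ∃ x₀ : ℝ, ∀ x : ℝ, x₀ ≤ x → N < (goodCount x : ℝ) := by
  obtain ⟨x₀, hx₀⟩ := h
  intro N
  -- `(1/5)(4x/π²) ≥ N` as soon as `x ≥ 5π²N/4`
  refine ⟨max x₀ (5 * Real.pi ^ 2 * |N| / 4), fun x hx => ?_⟩
  have h1 := hx₀ x (le_trans (le_max_left _ _) hx)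
  have hx2 : 5 * Real.pi ^ 2 * |N| / 4 ≤ x := le_trans (le_max_right _ _) hx
  have hpi : 0 < Real.pi ^ 2 := by positivity
  have hN : |N| ≤ (1 / 5 : ℝ) * (4 * x / Real.pi ^ 2) := by
    rw [show (1 / 5 : ℝ) * (4 * x / Real.pi ^ 2) = (4 * x / 5) / Real.pi ^ 2 by ring,
      le_div_iff₀ hpi]
    nlinarith
  linarith [le_abs_self N]

/-- **Range versus proportion** (PROVED): under a certified leaf `NoRealZeroOddUpTo Q`, for EVERY
`d ≥ 1` with `8d ≤ Q` (so `3 ≤ 8d`), every odd primitive quadratic character mod `8d` — i.e.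
`χ_{−8d}` when `d` is odd and square-free — has no zero in the open interval `(0, 1)`: on the range
`8d ≤ Q` the certified tables give 100 %, where Theorem 1 gives 20 % at all conductors.
[cite: ConreySoundararajan2002, §1 Theorem 1] [cite: Watkins2004RealZeros, main theorem] -/
theorem noRealZero_of_leaf {Q : ℕ} (hQ : NoRealZeroOddUpTo Q) {d : ℕ} (hd : 1 ≤ d)
    (hdQ : 8 * d ≤ Q) (χ : DirichletCharacter ℂ (8 * d)) (hprim : χ.IsPrimitive)
    (hquad : χ.IsQuadratic) (hodd : χ.Odd) {σ : ℝ} (h0 : 0 < σ) (h1 : σ < 1) :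
    haveI : NeZero (8 * d) := ⟨by omega⟩
    χ.LFunction σ ≠ 0 := by
  haveI : NeZero (8 * d) := ⟨by omega⟩
  exact hQ (8 * d) (by omega) hdQ χ hquad hprim hodd σ h0 h1

end ConreySoundararajan2002

end Literature.NumberTheory.LFunctions

end
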